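import Literature.Computability.AlgebraicComplexity.AndrewsForbes2022Lemma210CharZero
import HarnessLib

/-!
# The Second Fundamental Theorem for `GL_t` (kernel form) over EVERY field, by characteristic-free
straightening — and Andrews–Forbes 2022, Lemma 2.10 DISCHARGED (`AndrewsForbes2022_lemma_2_10_holds`)

Sibling proofs file of `SecondFundamentalTheoremGLProofs.lean` / `DeterminantalIdealSFT.lean` /
`AndrewsForbes2022Applications.lean`.  The tree's proof of the Second Fundamental Theorem
(Arbarello–Cornalba–Griffiths–Harris, *Geometry of Algebraic Curves* I, Ch. II §3, standard-monomial
argument) uses characteristic `0` in exactly one place: the straightening step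
`tabVal_mem_stdSpan_of_strictMono` sums the permutation-form Plücker relation over ALL permutations
`σ` of the `n + 1` pooled positions and divides by the order `(n−s)!(s+1)!` of the stabiliser of the
two rows.  This file removes that division:

* `ArbarelloEtAl1985.exch_mul`, `…sign_mul_tabVal_exch_mul_stab`, `…stab_of_key_eq`,
  `…key_mul_of_stab` — the signed term `sign σ · (τ^σ)` of the relation is constant on the LEFT
  COSETS `σ · Stab` (key: `q ↦ (σ⁻¹ q).isLeft`), because exchanging along `σπ` is exchanging along `σ`
  and then along `π`;
* `ArbarelloEtAl1985.sum_sign_mul_tabVal_exch_eq_card_smul` — hence the relation reads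
  `|Stab| · Σ_{cosets} sign(rep) (τ^{rep}) = 0` over every commutative ring;
* `ArbarelloEtAl1985.exists_straightening_relation` — in the GENERIC ring `ℤ[x_{ij}]` (a domain of
  characteristic `0`) the factor `|Stab|` cancels, and the integral relation
  `(τ) = −Σ_{cosets ≠ Stab} sign(rep) (τ^{rep})` specialises (`eval₂`) to every commutative ring `A`;
  the representatives lie outside the stabiliser, so their potential is smaller (`pot_exch_lt`);
* `ArbarelloEtAl1985.tabVal_mem_stdSpan'`, `…mem_allStdSpan'`, `…mem_detIdeal_sup_span'` — the
  straightening law and "standard monomials generate" over EVERY field;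
* `ArbarelloEtAl1985.mem_detIdeal_of_phi_eq_zero'` and
  `ker_genericProductHom_eq_determinantalIdeal_field` — **the kernel of `X ↦ Y Z` (generic `m × t`
  times `t × n`) is `I_{t+1}(X)` over every field** (De Concini–Eisenbud–Procesi 1980 / Bruns–Vetter
  1988; the TODO "ker μ^* = I_{t+1} over an arbitrary domain" of `DeterminantalIdealSFT.lean` is thus
  settled for fields of every characteristic);
* `AndrewsForbes2022_lemma_2_10_allFields` and **`AndrewsForbes2022_lemma_2_10_holds :
  AndrewsForbes2022_lemma_2_10`** — Andrews–Forbes 2022 Lemma 2.10 (`f(𝒢_{n,m,r-1}(Y,Z)) = 0 ↔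
  f ∈ I^det_{n,m,r}`, every field, `r ≥ 1`; printed hypothesis `r ≤ min(n,m)` not needed),
  the named fact of `AndrewsForbes2022Applications.lean`, DISCHARGED.

Theorem-only file; no new facts, no definitions.  Honest framing: a classical commutative-algebra
theorem (SFT for `GL_t` over a field) and a typed literature lemma are now kernel-checked in every
characteristic; VP ≠ VNP is NOT proved and nothing here bears on it.

## References
* [ArbarelloEtAl1985] E. Arbarello, M. Cornalba, P. A. Griffiths, J. Harris, *Geometry of Algebraic
  Curves* I, Springer 1985, Ch. II §3, pp. 70–75 (Plücker relations, straightening, SFT).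
* C. De Concini, D. Eisenbud, C. Procesi, *Young diagrams and determinantal varieties*, Invent. Math.
  56 (1980); W. Bruns, U. Vetter, *Determinantal Rings*, LNM 1327 (1988), §4 (characteristic-free
  straightening, the result re-derived here).
* [GoodmanWallachGTM255] R. Goodman, N. Wallach, GTM 255, Thm. 12.2.12 (kernel form over `ℂ`).
* [AndrewsForbes2022] R. Andrews, M. A. Forbes, STOC 2022, arXiv:2112.00792, Construction 2.8 and
  Lemma 2.10 (p0013).
-/

noncomputable section

open MvPolynomial Matrix Equiv Equiv.Perm

namespace Literature.Computability.AlgebraicComplexity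

namespace ArbarelloEtAl1985

/-! ### Char-free straightening: the Plücker relation along the cosets of the row stabiliser -/

section CharFree

variable {F A : Type*} [Field F] [CommRing A] [Algebra F A]
variable {N n : ℕ} (M : Matrix (Fin N) (Fin n) A)
variable {h : ℕ} (τ : Fin h → Fin n → Fin N) {r₀ r₁ : Fin h}

/-- Composition of exchanges: exchanging along `σ * π` is exchanging along `σ` and then along `π`.
[folklore] -/
private theorem exch_mul (hne : r₀ ≠ r₁) (s : Fin n) (σ π : Perm {q // q ∈ poolSet s}) :
    exch τ r₀ r₁ (ofSubtype (σ * π)) = exch (exch τ r₀ r₁ (ofSubtype σ)) r₀ r₁ (ofSubtype π) := by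
  have key : ∀ x : Fin n ⊕ Fin n,
      Sum.elim (exch τ r₀ r₁ (ofSubtype σ) r₀) (exch τ r₀ r₁ (ofSubtype σ) r₁) x =
        Sum.elim (τ r₀) (τ r₁) (ofSubtype σ x) := by
    intro x
    rcases x with i | j
    · rw [Sum.elim_inl, exch_row₀]
    · rw [Sum.elim_inr, exch_row₁ τ hne]
  funext r
  by_cases h₀ : r = r₀
  · subst h₀
    rw [exch_row₀, exch_row₀]
    funext i
    rw [key, map_mul, Perm.mul_apply]
  · by_cases h₁ : r = r₁
    · subst h₁
      rw [exch_row₁ τ hne, exch_row₁ _ hne]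
      funext j
      rw [key, map_mul, Perm.mul_apply]
    · rw [exch_of_ne τ _ h₀ h₁, exch_of_ne _ _ h₀ h₁, exch_of_ne τ _ h₀ h₁]

/-- Right multiplication by a permutation preserving the two rows does not change the signed term
of the Plücker relation. [cite: ArbarelloEtAl1985, Ch. II §3, p. 64] -/
theorem sign_mul_tabVal_exch_mul_stab (hne : r₀ ≠ r₁) (s : Fin n) (σ π : Perm {q // q ∈ poolSet s})
    (hπ : ∀ q, (π q : Fin n ⊕ Fin n).isLeft = (q : Fin n ⊕ Fin n).isLeft) :
    ((sign (σ * π) : ℤ) : A) * tabVal M (exch τ r₀ r₁ (ofSubtype (σ * π))) =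
      ((sign σ : ℤ) : A) * tabVal M (exch τ r₀ r₁ (ofSubtype σ)) := by
  rw [exch_mul τ hne, map_mul, Units.val_mul, Int.cast_mul, mul_assoc,
    sign_mul_tabVal_exch_of_stab (exch τ r₀ r₁ (ofSubtype σ)) hne s π hπ]

/-- The coset key of a pool permutation: which positions it fills FROM the upper row. Two
permutations have the same key iff they differ by an element of the two-row stabiliser on the
right. [folklore] -/
private theorem stab_of_key_eq {s : Fin n} (σ σ' : Perm {q // q ∈ poolSet s})
    (hkey : (fun q => ((σ.symm q : {q // q ∈ poolSet s}) : Fin n ⊕ Fin n).isLeft) =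
      fun q => ((σ'.symm q : {q // q ∈ poolSet s}) : Fin n ⊕ Fin n).isLeft) :
    ∀ q, (((σ⁻¹ * σ') q : {q // q ∈ poolSet s}) : Fin n ⊕ Fin n).isLeft =
      (q : Fin n ⊕ Fin n).isLeft := by
  intro q
  have h1 : ((σ.symm (σ' q) : {q // q ∈ poolSet s}) : Fin n ⊕ Fin n).isLeft =
      ((σ'.symm (σ' q) : {q // q ∈ poolSet s}) : Fin n ⊕ Fin n).isLeft := congrFun hkey (σ' q)
  rw [Perm.mul_apply, Perm.inv_def, h1, Equiv.symm_apply_apply]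

/-- A stabiliser element on the right does not change the key. [folklore] -/
private theorem key_mul_of_stab {s : Fin n} (σ π : Perm {q // q ∈ poolSet s})
    (hπ : ∀ q, (π q : Fin n ⊕ Fin n).isLeft = (q : Fin n ⊕ Fin n).isLeft) :
    (fun q => (((σ * π).symm q : {q // q ∈ poolSet s}) : Fin n ⊕ Fin n).isLeft) =
      fun q => ((σ.symm q : {q // q ∈ poolSet s}) : Fin n ⊕ Fin n).isLeft := by
  funext q
  have h1 := hπ (π.symm (σ.symm q))
  rw [Equiv.apply_symm_apply] at h1
  show (((σ * π).symm q : {q // q ∈ poolSet s}) : Fin n ⊕ Fin n).isLeft = _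
  rw [show (σ * π).symm q = π.symm (σ.symm q) from rfl]
  exact h1.symm

/-- `tabVal` commutes with ring homomorphisms. [folklore] -/
private theorem map_tabVal {B : Type*} [CommRing B] (φ : A →+* B) (θ : Fin h → Fin n → Fin N) :
    φ (tabVal M θ) = tabVal (M.map φ) θ := by
  unfold tabVal
  rw [map_prod]
  refine Finset.prod_congr rfl fun r _ => ?_
  rw [RingHom.map_det, RingHom.mapMatrix_apply, Matrix.submatrix_map]

/-- The permutation-form Plücker sum decomposed along the left cosets of the two-row stabiliser
(fibres of the key `σ ↦ (q ↦ (σ⁻¹ q).isLeft)`): each coset contributes `|Stab|` copies of the term of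
its representative. Valid over every commutative ring. [cite: ArbarelloEtAl1985, Ch. II §3, p. 64] -/
theorem sum_sign_mul_tabVal_exch_eq_card_smul {B : Type*} [CommRing B] (MB : Matrix (Fin N) (Fin n) B)
    (hne : r₀ ≠ r₁) (s : Fin n)
    (rep : ({q // q ∈ poolSet s} → Bool) → Perm {q // q ∈ poolSet s})
    (hrep : ∀ b ∈ Finset.univ.image (fun (σ : Perm {q // q ∈ poolSet s}) (q : {q // q ∈ poolSet s}) =>
        ((σ.symm q : {q // q ∈ poolSet s}) : Fin n ⊕ Fin n).isLeft),
      (fun q => (((rep b).symm q : {q // q ∈ poolSet s}) : Fin n ⊕ Fin n).isLeft) = b) :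
    (∑ σ : Perm {q // q ∈ poolSet s}, ((sign σ : ℤ) : B) * tabVal MB (exch τ r₀ r₁ (ofSubtype σ))) =
      (Finset.univ.filter fun π : Perm {q // q ∈ poolSet s} =>
          ∀ q, (π q : Fin n ⊕ Fin n).isLeft = (q : Fin n ⊕ Fin n).isLeft).card •
        ∑ b ∈ Finset.univ.image (fun (σ : Perm {q // q ∈ poolSet s}) (q : {q // q ∈ poolSet s}) =>
            ((σ.symm q : {q // q ∈ poolSet s}) : Fin n ⊕ Fin n).isLeft),
          ((sign (rep b) : ℤ) : B) * tabVal MB (exch τ r₀ r₁ (ofSubtype (rep b))) := by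
  classical
  set key : Perm {q // q ∈ poolSet s} → ({q // q ∈ poolSet s} → Bool) :=
    fun σ q => ((σ.symm q : {q // q ∈ poolSet s}) : Fin n ⊕ Fin n).isLeft with hkey
  set Stab : Finset (Perm {q // q ∈ poolSet s}) :=
    Finset.univ.filter fun π => ∀ q, (π q : Fin n ⊕ Fin n).isLeft = (q : Fin n ⊕ Fin n).isLeft
    with hStab
  rw [← Finset.sum_fiberwise_of_maps_to (s := Finset.univ) (t := Finset.univ.image key) (g := key)
    (fun σ _ => Finset.mem_image_of_mem key (Finset.mem_univ σ)), Finset.smul_sum]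
  refine Finset.sum_congr rfl fun b hb => ?_
  have hconst : ∀ σ ∈ Finset.univ.filter (fun σ => key σ = b),
      ((sign σ : ℤ) : B) * tabVal MB (exch τ r₀ r₁ (ofSubtype σ)) =
        ((sign (rep b) : ℤ) : B) * tabVal MB (exch τ r₀ r₁ (ofSubtype (rep b))) := by
    intro σ hσ
    have hk : key (rep b) = key σ := (hrep b hb).trans (Finset.mem_filter.mp hσ).2.symm
    have := sign_mul_tabVal_exch_mul_stab MB τ hne s (rep b) ((rep b)⁻¹ * σ)
      (stab_of_key_eq _ _ hk)
    rwa [mul_inv_cancel_left] at this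
  rw [Finset.sum_congr rfl hconst, Finset.sum_const]
  congr 1
  symm
  refine Finset.card_bij (fun π _ => rep b * π) (fun π hπ => ?_) (fun π₁ _ π₂ _ h => ?_)
    (fun σ hσ => ?_)
  · rw [Finset.mem_filter]
    refine ⟨Finset.mem_univ _, ?_⟩
    rw [hStab, Finset.mem_filter] at hπ
    have := key_mul_of_stab (rep b) π hπ.2
    exact this.trans (hrep b hb)
  · exact mul_left_cancel h
  · refine ⟨(rep b)⁻¹ * σ, ?_, mul_inv_cancel_left _ _⟩
    rw [hStab, Finset.mem_filter]
    refine ⟨Finset.mem_univ _, stab_of_key_eq _ _ ?_⟩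
    exact (hrep b hb).trans (Finset.mem_filter.mp hσ).2.symm

/-- **The char-free straightening relation.** At a pool of `n + 1` positions the value of `τ` is a
signed sum of values of exchanged tableaux along permutations OUTSIDE the two-row stabiliser (one per
nontrivial coset): the permutation-form Plücker relation `sum_sign_mul_tabVal_exch` is constant on the
left cosets of the stabiliser, the common factor (the order of the stabiliser) is cancelled in the
generic ring `ℤ[x_{ij}]` (a domain of characteristic `0`), and the resulting integral relation is
specialised to `A`. Valid over every commutative ring `A`.
[cite: ArbarelloEtAl1985, Ch. II §3, p. 64 (Plücker relations / straightening)] -/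
theorem exists_straightening_relation (hne : r₀ ≠ r₁) (s : Fin n) :
    ∃ ι : Finset (Perm {q // q ∈ poolSet s}),
      (∀ σ ∈ ι, ¬ ∀ q, (σ q : Fin n ⊕ Fin n).isLeft = (q : Fin n ⊕ Fin n).isLeft) ∧
      tabVal M τ = -∑ σ ∈ ι, ((sign σ : ℤ) : A) * tabVal M (exch τ r₀ r₁ (ofSubtype σ)) := by
  classical
  -- the coset key, the representatives, the stabiliser
  set key : Perm {q // q ∈ poolSet s} → ({q // q ∈ poolSet s} → Bool) :=
    fun σ q => ((σ.symm q : {q // q ∈ poolSet s}) : Fin n ⊕ Fin n).isLeft with hkey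
  set rep : ({q // q ∈ poolSet s} → Bool) → Perm {q // q ∈ poolSet s} := Function.invFun key
    with hrep
  set T : Finset ({q // q ∈ poolSet s} → Bool) := Finset.univ.image key with hT
  set Stab : Finset (Perm {q // q ∈ poolSet s}) :=
    Finset.univ.filter fun π => ∀ q, (π q : Fin n ⊕ Fin n).isLeft = (q : Fin n ⊕ Fin n).isLeft
    with hStab
  have hrepT : ∀ b ∈ T, key (rep b) = b := fun b hb => by
    obtain ⟨σ, -, hσ⟩ := Finset.mem_image.mp hb
    exact Function.invFun_eq ⟨σ, hσ⟩
  have h1Stab : (1 : Perm {q // q ∈ poolSet s}) ∈ Stab := by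
    rw [hStab, Finset.mem_filter]; exact ⟨Finset.mem_univ _, fun q => rfl⟩
  -- (2) the generic ring: cancel the order of the stabiliser
  have hgen : ∑ b ∈ T, ((sign (rep b) : ℤ) : MvPolynomial (Fin N × Fin n) ℤ) *
      tabVal (mvPolynomialX (Fin N) (Fin n) ℤ) (exch τ r₀ r₁ (ofSubtype (rep b))) = 0 := by
    have h1 := sum_sign_mul_tabVal_exch_eq_card_smul τ (mvPolynomialX (Fin N) (Fin n) ℤ) hne s rep hrepT
    rw [sum_sign_mul_tabVal_exch (M := mvPolynomialX (Fin N) (Fin n) ℤ) τ hne s, nsmul_eq_mul,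
      eq_comm, mul_eq_zero] at h1
    refine h1.resolve_left ?_
    exact Nat.cast_ne_zero.mpr (Finset.card_ne_zero.mpr ⟨1, h1Stab⟩)
  -- (3) specialise to `A`
  set ev : MvPolynomial (Fin N × Fin n) ℤ →+* A :=
    MvPolynomial.eval₂Hom (Int.castRingHom A) (fun p => M p.1 p.2) with hev
  have hevM : (mvPolynomialX (Fin N) (Fin n) ℤ).map ev = M := by
    rw [hev, MvPolynomial.coe_eval₂Hom]
    exact Matrix.mvPolynomialX_map_eval₂ (Int.castRingHom A) M
  have hA : ∑ b ∈ T, ((sign (rep b) : ℤ) : A) * tabVal M (exch τ r₀ r₁ (ofSubtype (rep b))) = 0 := by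
    have := congrArg ev hgen
    rw [map_sum, map_zero] at this
    rw [← this]
    refine Finset.sum_congr rfl fun b _ => ?_
    rw [map_mul, map_intCast, map_tabVal, hevM]
  -- (4) split off the trivial coset
  have hb₀ : key 1 ∈ T := Finset.mem_image_of_mem key (Finset.mem_univ 1)
  have h0 : ((sign (rep (key 1)) : ℤ) : A) * tabVal M (exch τ r₀ r₁ (ofSubtype (rep (key 1)))) =
      tabVal M τ := by
    have hk : key (rep (key 1)) = key 1 := hrepT _ hb₀
    have h := sign_mul_tabVal_exch_mul_stab M τ hne s (rep (key 1)) ((rep (key 1))⁻¹ * 1)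
      (stab_of_key_eq _ _ hk)
    rw [mul_inv_cancel_left] at h
    rw [← h]
    exact sign_mul_tabVal_exch_of_stab τ hne s 1 fun q => rfl
  rw [← Finset.add_sum_erase T _ hb₀, h0] at hA
  refine ⟨(T.erase (key 1)).image rep, fun σ hσ hstab => ?_, ?_⟩
  · obtain ⟨b, hb, rfl⟩ := Finset.mem_image.mp hσ
    have hk : key (rep b) = b := hrepT b (Finset.mem_of_mem_erase hb)
    have hk1 : key (1 * rep b) = key 1 := key_mul_of_stab 1 (rep b) hstab
    rw [one_mul, hk] at hk1
    exact (Finset.mem_erase.mp hb).1 hk1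
  · rw [Finset.sum_image fun b hb b' hb' h => by
      rw [← hrepT b (Finset.mem_of_mem_erase hb), ← hrepT b' (Finset.mem_of_mem_erase hb'), h]]
    exact eq_neg_of_add_eq_zero_left hA

end CharFree


/-! ### Straightening over every field -/

section StraighteningAllChar

variable {F A : Type*} [Field F] [CommRing A] [Algebra F A]
variable {N n : ℕ} {M : Matrix (Fin N) (Fin n) A}

/-- **Straightening, every characteristic** (ACGH, Ch. II §3, Lemma p. 63, without the division
by the order of the stabiliser): the value of every tableau with increasing rows is an
`F`-combination of values of standard tableaux. [cite: ArbarelloEtAl1985, Ch. II §3, Lemma p. 63] -/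
theorem tabVal_mem_stdSpan_of_strictMono' {h : ℕ} (P : ℕ) :
    ∀ τ : Fin h → Fin n → Fin N, (∀ r, StrictMono (τ r)) → pot τ = P →
      tabVal M τ ∈ stdSpan M F h := by
  classical
  induction P using Nat.strong_induction_on with
  | _ P ih =>
  intro τ hrows hP
  by_cases hstd : τ ∈ stdTabs N n h
  · exact tabVal_mem_stdSpan_of_mem hstd
  have hcol : ∃ i, ¬ Monotone (fun r => τ r i) := by
    by_contra hall
    push Not at hall
    exact hstd ⟨hrows, hall⟩
  obtain ⟨s, hs⟩ := hcol
  obtain ⟨r₀, r₁, hr, hviol⟩ := exists_consec_lt hs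
  have hne : r₀ ≠ r₁ := Fin.ne_of_val_ne (by omega)
  obtain ⟨ι, hι, hrel⟩ := exists_straightening_relation M τ hne s
  have hrest : ∀ σ ∈ ι,
      ((sign σ : ℤ) : A) * tabVal M (exch τ r₀ r₁ (ofSubtype σ)) ∈ stdSpan M F h := by
    intro σ hσ
    have hpot := pot_exch_lt τ hr (hrows r₀) (hrows r₁) hviol σ (hι σ hσ)
    have hmem : tabVal M (exch τ r₀ r₁ (ofSubtype σ)) ∈ stdSpan M F h :=
      tabVal_mem_of_forall_sorted _ _ fun τ'' hτ'' hpot'' =>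
        ih (pot τ'') (by rw [hpot'', ← hP]; exact hpot) τ'' hτ'' rfl
    rw [← zsmul_eq_mul]
    exact zsmul_mem hmem _
  rw [hrel]
  exact Submodule.neg_mem _ (Submodule.sum_mem _ hrest)

/-- **Straightening, every characteristic**, for an arbitrary tableau.
[cite: ArbarelloEtAl1985, Ch. II §3, Lemma p. 63] -/
theorem tabVal_mem_stdSpan' {h : ℕ} (τ : Fin h → Fin n → Fin N) :
    tabVal M τ ∈ stdSpan M F h :=
  tabVal_mem_of_forall_sorted τ _ fun τ'' hτ'' _ =>
    tabVal_mem_stdSpan_of_strictMono' (pot τ'') τ'' hτ'' rfl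

end StraighteningAllChar

/-! ### Part D over every field -/

section SpanPartAllChar

variable {F : Type*} [Field F] {m n k : ℕ}

/-- `allStdSpan` is stable under multiplication by variables, every characteristic.
[cite: ArbarelloEtAl1985, Ch. II §3, p. 65] -/
theorem mul_X_mem_allStdSpan' {x : MvPolynomial (Fin m × Fin n) F}
    (hx : x ∈ allStdSpan F m n) (ij : Fin m × Fin n) : x * X ij ∈ allStdSpan F m n := by
  induction hx using Submodule.span_induction with
  | mem x hx =>
    obtain ⟨h, τ, hτ, rfl⟩ := hx
    obtain ⟨π, hπ⟩ := X_eq_sign_mul_det_cvar (F := F) ij.1 ij.2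
    rw [show X ij = X (ij.1, ij.2) from rfl, hπ, mul_left_comm, ← tabVal_snoc, ← zsmul_eq_mul]
    exact zsmul_mem (stdSpan_le_allStdSpan (h + 1) (tabVal_mem_stdSpan' _)) _
  | zero => rw [zero_mul]; exact zero_mem _
  | add x y _ _ hx hy => rw [add_mul]; exact add_mem hx hy
  | smul a x _ hx => rw [smul_mul_assoc]; exact Submodule.smul_mem _ a hx

/-- **The standard monomials generate** `F[x_{ij}]`, every characteristic (ACGH p. 65).
[cite: ArbarelloEtAl1985, Ch. II §3, p. 65] -/
theorem mem_allStdSpan' (P : MvPolynomial (Fin m × Fin n) F) : P ∈ allStdSpan F m n := by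
  induction P using MvPolynomial.induction_on with
  | C a => rw [C_eq_smul_one]; exact Submodule.smul_mem _ a one_mem_allStdSpan
  | add p q hp hq => exact add_mem hp hq
  | mul_X p ij hp => exact mul_X_mem_allStdSpan' hp ij

/-- **(S1), every characteristic.** Every polynomial is congruent modulo `I_{k+1}` to an
`F`-combination of values of standard tableaux whose rows all have `X`-length in `[1, k]`.
[cite: ArbarelloEtAl1985, Ch. II §3, pp. 65–66] -/
theorem mem_detIdeal_sup_span' (P : MvPolynomial (Fin m × Fin n) F) :
    P ∈ (detIdeal F m n (k + 1)).restrictScalars F ⊔ Submodule.span F (stdBasisSet F m n k) := by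
  have hP := mem_allStdSpan' (F := F) (m := m) (n := n) P
  refine (Submodule.span_le.mpr ?_) hP
  rintro x ⟨h, τ, hτ, rfl⟩
  exact tabVal_mem_sup_of_std hτ

end SpanPartAllChar

/-! ### The kernel form of the Second Fundamental Theorem over every field -/

/-- **Kernel form of the Second Fundamental Theorem, every field.** If `φ(P) = 0` for the
substitution `φ : X ↦ U Vᵀ` through inner dimension `k`, then `P ∈ I_{k+1}`.
[cite: ArbarelloEtAl1985, Ch. II §3, Second Fundamental Theorem (pp. 70–74)] -/
theorem mem_detIdeal_of_phi_eq_zero' {F : Type*} [Field F] {k m n : ℕ}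
    (P : MvPolynomial (Fin m × Fin n) F) (hφ : phi F k m n P = 0) :
    P ∈ detIdeal F m n (k + 1) := by
  classical
  obtain ⟨i, hi, q, hq, hiq⟩ :=
    Submodule.mem_sup.mp (mem_detIdeal_sup_span' (F := F) (m := m) (n := n) (k := k) P)
  rw [Submodule.restrictScalars_mem] at hi
  have hφq : phi F k m n q = 0 := by
    have h1 := hφ
    rwa [← hiq, map_add, phi_eq_zero_of_mem_detIdeal hi, zero_add] at h1
  have hq0 : q = 0 := by
    obtain ⟨c, t, ht, -, hsum⟩ := Submodule.mem_span_iff_exists_finset_subset.mp hq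
    have hsum' : ∑ f ∈ t, c f • phi F k m n f = 0 := by
      have := congrArg (phi F k m n) hsum
      rw [map_sum, hφq] at this
      simpa only [map_smul] using this
    have hinj : Set.InjOn (fun f => MonomialOrder.lex.degree (phi F k m n f)) t := by
      intro f hf g hg hfg
      obtain ⟨h₁, τ₁, hτ₁, hb₁, rfl⟩ := ht hf
      obtain ⟨h₂, τ₂, hτ₂, hb₂, rfl⟩ := ht hg
      simp only at hfg
      rw [(degree_phi_tabVal τ₁ hτ₁.1 (fun r => (hb₁ r).2)).1,
        (degree_phi_tabVal τ₂ hτ₂.1 (fun r => (hb₂ r).2)).1] at hfg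
      exact tabVal_eq_of_tabDeg_eq hτ₁ hτ₂ (fun r => (hb₁ r).1) (fun r => (hb₂ r).1) _ _ hfg
    have hne : ∀ f ∈ t, phi F k m n f ≠ 0 := by
      intro f hf
      obtain ⟨h₁, τ₁, hτ₁, hb₁, rfl⟩ := ht hf
      exact MonomialOrder.leadingCoeff_ne_zero_iff.mp
        (degree_phi_tabVal τ₁ hτ₁.1 (fun r => (hb₁ r).2)).2
    have hc := eq_zero_of_sum_smul_eq_zero t (fun f => phi F k m n f) hinj hne c hsum'
    rw [← hsum]
    exact Finset.sum_eq_zero fun f hf => by rw [hc f hf, zero_smul]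
  rw [hq0, add_zero] at hiq
  rw [← hiq]
  exact hi

/-- The renaming `u_{i,t} ↦ y_{i,t}`, `v_{j,t} ↦ z_{t,j}` relating `φ` to the generic-product
comorphism. [folklore] -/
private theorem genericProductHom_eq_rename_comp_phi' (F : Type*) [Field F] (k m n : ℕ) :
    (genericProductHom (Fin m) (Fin n) F k : MvPolynomial (Fin m × Fin n) F →ₐ[F] _) =
      (rename fun v : Var k m n =>
          Sum.elim (fun i : Fin m => (Sum.inl (i, (ofLex v).1) : (Fin m × Fin k) ⊕ (Fin k × Fin n)))
            (fun j : Fin n => Sum.inr ((ofLex v).1, j)) (finSumFinEquiv.symm (ofLex v).2)).comp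
        (phi F k m n) := by
  refine MvPolynomial.algHom_ext fun ij => ?_
  rw [genericProductHom_X, AlgHom.comp_apply, phi_X]
  simp only [Matrix.mul_apply, Matrix.transpose_apply, Ugen, Vgen, map_sum, map_mul, rename_X]
  refine Finset.sum_congr rfl fun t _ => ?_
  simp [uVar, vVar]

/-- The renaming above is injective. [folklore] -/
private theorem rename_var_injective' (k m n : ℕ) :
    Function.Injective fun v : Var k m n =>
      Sum.elim (fun i : Fin m => (Sum.inl (i, (ofLex v).1) : (Fin m × Fin k) ⊕ (Fin k × Fin n)))
        (fun j : Fin n => Sum.inr ((ofLex v).1, j)) (finSumFinEquiv.symm (ofLex v).2) := by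
  refine Function.HasLeftInverse.injective
    ⟨Sum.elim (fun p : Fin m × Fin k => toLex (p.2, Fin.castAdd n p.1))
      (fun p : Fin k × Fin n => toLex (p.1, Fin.natAdd m p.2)), fun v => ?_⟩
  rcases h : finSumFinEquiv.symm (ofLex v).2 with i | j
  · have hi : (ofLex v).2 = Fin.castAdd n i := by
      rw [Equiv.symm_apply_eq] at h; rw [h]; rfl
    simp only [h, Sum.elim_inl]
    rw [← hi]
    simp
  · have hj : (ofLex v).2 = Fin.natAdd m j := by
      rw [Equiv.symm_apply_eq] at h; rw [h]; rfl
    simp only [h, Sum.elim_inr]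
    rw [← hj]
    simp

end ArbarelloEtAl1985

open ArbarelloEtAl1985 in
/-- **Second Fundamental Theorem, kernel form, EVERY field:** the kernel of the comorphism
`μ^* : F[X] → F[Y, Z]`, `X ↦ Y Z` (`Y` generic `m × t`, `Z` generic `t × n`) is the determinantal
ideal `I_{t+1}(X)`. (Goodman–Wallach Thm. 12.2.12 over `ℂ`; De Concini–Eisenbud–Procesi 1980 /
Bruns–Vetter 1988 over every field — here by ACGH's standard-monomial argument with the
characteristic-free straightening above.)
[cite: GoodmanWallachGTM255, Thm. 12.2.12; ArbarelloEtAl1985, Ch. II §3] -/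
theorem ker_genericProductHom_eq_determinantalIdeal_field (F : Type*) [Field F] (m n t : ℕ) :
    RingHom.ker (genericProductHom (Fin m) (Fin n) F t) = determinantalIdeal (Fin m) (Fin n) F (t + 1) := by
  refine le_antisymm ?_ (determinantalIdeal_le_ker_genericProductHom F t)
  intro P hP
  rw [RingHom.mem_ker] at hP
  rw [determinantalIdeal_eq_detIdeal]
  refine mem_detIdeal_of_phi_eq_zero' P ?_
  have h := congrArg (fun g : MvPolynomial (Fin m × Fin n) F →ₐ[F] _ => g P)
    (genericProductHom_eq_rename_comp_phi' F t m n)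
  simp only [AlgHom.comp_apply] at h
  change genericProductHom (Fin m) (Fin n) F t P = _ at h
  rw [hP] at h
  exact rename_injective _ (rename_var_injective' t m n) (by rw [map_zero]; exact h.symm)

/-- **Andrews–Forbes 2022, Lemma 2.10, every field** (all `n, m` and `r ≥ 1`; the printed
`r ≤ min(n,m)` is not needed): `f(𝒢_{n,m,r-1}(Y,Z)) = 0 ↔ f ∈ I^det_{n,m,r}`.
[cite: AndrewsForbes2022, Lemma 2.10] -/
theorem AndrewsForbes2022_lemma_2_10_allFields (F : Type) [Field F] (n m r : ℕ) (hr : 1 ≤ r)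
    (f : MvPolynomial (Fin n × Fin m) F) :
    MvPolynomial.bind₁ (matrixGenerator F n m (r - 1)) f = 0 ↔ f ∈ detIdeal F n m r := by
  obtain ⟨t, rfl⟩ : ∃ t, r = t + 1 := ⟨r - 1, by omega⟩
  rw [Nat.add_sub_cancel, ← determinantalIdeal_eq_detIdeal,
    ← ker_genericProductHom_eq_determinantalIdeal_field, RingHom.mem_ker,
    bind₁_matrixGenerator_eq_genericProductHom]

/-- **Andrews–Forbes 2022, Lemma 2.10 — the named fact DISCHARGED** (every field, `1 ≤ r ≤ min n m`
as printed). [cite: AndrewsForbes2022, Lemma 2.10] -/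
theorem AndrewsForbes2022_lemma_2_10_holds : AndrewsForbes2022_lemma_2_10 := by
  intro F _ n m r hr _ f
  exact AndrewsForbes2022_lemma_2_10_allFields F n m r hr f

end Literature.Computability.AlgebraicComplexity

end
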